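import Summits.BirchSwinnertonDyer.BirchSwinnertonDyer.Theses.BiquadraticEisensteinDescent
import Summits.BirchSwinnertonDyer.BirchSwinnertonDyer.Theorems.BiquadraticEisensteinDescentKatzWaldspurgerFrameCMInertBadFlatKPrimeBody
import HarnessLib

/-!
# `BiquadraticEisensteinDescent.KatzWaldspurgerFrameCMInertBadFlatKPrimeOfLZZ` holds (route BiquadraticEisensteinDescent,
# W-ALL row 12 · K12i; item stmt-BirchSwinnertonDyer-20712, rev 16 — director-bsd W-16/W-18 «Δ-h⁻», route author bsd-wall-cm g9)

The rev-16 decl `KatzWaldspurgerFrameCMInertBadFlatKPrimeOfLZZ := Hsieh2014.thmA_…_anyLevel →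
LiuZhangZhang2018.thm151_thm153_modularCurve_heegnerVector_additive → <the (W♭) body with the quartic admissibility binder
DELETED>` is, textually, the statement of the tree theorem `…Theorems.KatzWaldspurgerFrameCMInertBadFlatKPrimeBody.w10`
(p544353, prover seat bsd-wall-bed-p2 g7: the body of `…FlatBody.w9` minus its unused class-number hypothesis; proof =
`…FlatBody.frame_value_of_lzz` — ♭-frame from Hsieh Thm. A at any level, exact display from Liu–Zhang–Zhang Duke 167
Thm. 1.5.1/1.5.3 at an additive prime, X11b one-sided rigidity at `c ≠ 0`, zero-rigidity at `c = 0`). So the item closes by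
ONE `exact` (kernel pre-checks: HOME/bsd-wall-bed-p2/g7/GlueDeltaHMinusCheck.lean dfeb6da5a8ca7aa5 `wNoAdm_holds`;
cm g9 w18/GlueCheckOpt2.lean). The item is filed as an ITEM and not consumed by value only because `w10`'s module imports
the route file via `…FlatBody → …FromPrint` (import cycle).

HONEST FRAMING: THEOREMS ONLY (0 definitions, 0 named facts, 0 `sorry`). The decl is an IMPLICATION whose two antecedents
are the published inputs (route items `HsiehAnyLevelInput` 20456 and `LiuZhangZhangAdditiveInput` 20316, both visible by name
in `closes`); proving it asserts nothing about those inputs. BSD is not proved by this file. Prover seat bsd-wall-bed-p2 (g7),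
2026-08-27. References: [LiuZhangZhang2018] Duke Math. J. 167 (2018) Thm. 1.5.1, Thm. 1.5.3; [Hsieh2014] Doc. Math. 19 Thm. A;
[Castella2018] Thms. 3.1–3.2 (arXiv:1704.06608).
-/

set_option autoImplicit false

-- D-0017 layout: summit = sub-problem, so `Summit.BirchSwinnertonDyer.BirchSwinnertonDyer.…` is the mandated namespace.
set_option linter.dupNamespace false

namespace Summit.BirchSwinnertonDyer.BirchSwinnertonDyer.Theorems.BiquadraticEisensteinDescentKatzWaldspurgerFrameCMInertBadFlatKPrimeOfLZZ

/-- **(W″) granted its print inputs — the route decl `KatzWaldspurgerFrameCMInertBadFlatKPrimeOfLZZ` holds**: for every datum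
of the CM inert-bad corner over a Heegner field `K′` with `|d_K′| > 4` and `p ∤ c(Dt)` (NO class-number hypothesis), granted
Hsieh Thm. A at any level and the Liu–Zhang–Zhang `p`-adic Waldspurger formula at an additive prime, there is a ♭-frame whose
value at `𝟙` is `u·(log_ω P)²` with `‖u‖ ≤ 1`. Proof: the tree theorem `KatzWaldspurgerFrameCMInertBadFlatKPrimeBody.w10`
(p544353) has exactly this type. [cite: LiuZhangZhang2018, Thm 1.5.1 and Thm 1.5.3 (Duke Math. J. 167 pp. 748–749)]
[cite: Hsieh2014, Thm. A p. 712 (Doc. Math. 19)] -/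
theorem katzWaldspurgerFrameCMInertBadFlatKPrimeOfLZZ_proof :
    Summit.BirchSwinnertonDyer.BirchSwinnertonDyer.Theses.BiquadraticEisensteinDescent.KatzWaldspurgerFrameCMInertBadFlatKPrimeOfLZZ :=
  Summit.BirchSwinnertonDyer.BirchSwinnertonDyer.Theorems.KatzWaldspurgerFrameCMInertBadFlatKPrimeBody.w10

end Summit.BirchSwinnertonDyer.BirchSwinnertonDyer.Theorems.BiquadraticEisensteinDescentKatzWaldspurgerFrameCMInertBadFlatKPrimeOfLZZ
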